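import Summits.AtomisticToContinuum.HydrodynamicLimit.Theorems.LambertianContactSwapCollisionMomentBoundRung0
import Summits.AtomisticToContinuum.HydrodynamicLimit.Theorems.JParityClosureCollisionTightnessDomination
import HarnessLib

/-!
# `LambertianContactSwap.CollisionMomentBound` (stmt-AtomisticToContinuum-12102): the expectation is
# finite for EVERY `N` under local Gibbs data (the item with `∃ C ∀ N` weakened to `∀ N ∃ C`)

Helper file (`--supports stmt-AtomisticToContinuum-12102`).  The support item asks for a bound, UNIFORM in `N`, on
the mean of the normalised `|g|³`-weighted collision count under the local Gibbs laws with continuous profiles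
`(a₀, u₀, θ₀)`.  Rung 0 (`collisionMomentBound_const`, constant profiles) gives the uniform bound under the
homogeneous Gibbs laws; the domination `localGibbsMeasure σ a₀ u₀ θ₀ N ≤ Λ^{N+1} • localGibbsMeasure σ 1 0 θ₁ N`
(`exists_localGibbsMeasure_le_smul_const`, the measure form of `H(P_N | G_N) = O(N)`) then shows that for GENERAL
continuous profiles every one of the item's integrals is finite, with the (useless for the item, but honest)
constant `Λ^{N+1} · 16 (t+1) σ² I(0, θ₁)`:

* `collisionMomentBound_pointwise` — the body of the route decl with the last two quantifiers exchanged
  (`∀ N ∃ C` instead of `∃ C ∀ N`), for all continuous positive profiles.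

So the item is not false for a trivial reason (an infinite expectation at some fixed `N`); what is open is exactly
the uniformity in `N`, i.e. removing the factor `Λ^{N+1}` — which for the cubic weight cannot be done by any
equilibrium large-deviation input (see the module docstring of `…CollisionMomentBoundRung0` and the evidence memo
on the item).

References: H. Spohn, *Large Scale Dynamics of Interacting Particles* (1991), Part I §2.3–§3; C. Cercignani,
R. Illner, M. Pulvirenti, *The Mathematical Theory of Dilute Gases* (1994), App. 4.A.
-/

noncomputable section

open MeasureTheory Set Filter Topology
open scoped ENNReal BigOperators Classical

namespace Summit.AtomisticToContinuum.HydrodynamicLimit.Theorems.LambertianContactSwapCollisionMomentBound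

open Literature.Analysis.FluidPDE Literature.MathematicalPhysics.KineticTheory

/-- **Every integral of `CollisionMomentBound` is finite** (the decl body with `∀ N ∃ C` in place of `∃ C ∀ N`).
For continuous profiles `a₀, θ₀ > 0`, `u₀` there is `σ₀ > 0` such that for `0 < σ < σ₀`, every flow family
`Φ`, every `t ≥ 0` and every `N` there is `C` with
`∫⁻ ofReal ((N+1)^{-4/3} Σ_{m < K_t(z)} Σ_{i,j} [hit y_m i j] (1 + ‖vᵢ − vⱼ‖³)) dP_N ≤ ofReal C`,
`P_N = localGibbsLaw σ a₀ u₀ θ₀ N (Φ N)`: domination of `P_N` by `Λ^{N+1}` times the homogeneous Gibbs law of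
temperature `θ₁` (`exists_localGibbsMeasure_le_smul_const`) and rung 0 at `(1, 0, θ₁)`
(`collisionMomentBound_const`); `C = Λ^{N+1} C₀(t, σ, θ₁)`. [folklore] -/
theorem collisionMomentBound_pointwise {a₀ θ₀ : T3 → ℝ} {u₀ : T3 → V3} (ha : Continuous a₀)
    (hθ : Continuous θ₀) (hu : Continuous u₀) (ha0 : ∀ x, 0 < a₀ x) (hθ0 : ∀ x, 0 < θ₀ x) :
    ∃ σ₀ : ℝ, 0 < σ₀ ∧ ∀ σ : ℝ, 0 < σ → σ < σ₀ →
      ∀ Φ : (N : ℕ) → HardSphereFlow (Torus.geometry (Fin 3)) (hsDiameter σ N) (N + 1),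
      ∀ t : ℝ, 0 ≤ t → ∀ N : ℕ, ∃ C : ℝ,
        ∫⁻ z, ENNReal.ofReal (((N : ℝ) + 1) ^ (-(4 / 3 : ℝ)) *
          ∑ m ∈ Finset.range (Alexander.collisionCount (Torus.geometry (Fin 3)) (hsDiameter σ N) z t),
            ∑ i : Fin (N + 1), ∑ j : Fin (N + 1),
              (if i < j ∧
                  freeFlight (Torus.geometry (Fin 3)) (Alexander.freeExitTime (Torus.geometry (Fin 3))
                      (hsDiameter σ N) (Alexander.stateAfter (Torus.geometry (Fin 3)) (hsDiameter σ N)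
                      z m)).toReal (Alexander.stateAfter (Torus.geometry (Fin 3)) (hsDiameter σ N) z m) ∈
                    contactSet (Torus.geometry (Fin 3)) (N + 1) (hsDiameter σ N) i j ∧
                  IsIncoming (Torus.geometry (Fin 3)) (freeFlight (Torus.geometry (Fin 3))
                    (Alexander.freeExitTime (Torus.geometry (Fin 3)) (hsDiameter σ N)
                      (Alexander.stateAfter (Torus.geometry (Fin 3)) (hsDiameter σ N) z m)).toReal
                    (Alexander.stateAfter (Torus.geometry (Fin 3)) (hsDiameter σ N) z m)) i j
                then 1 + ‖((freeFlight (Torus.geometry (Fin 3)) (Alexander.freeExitTime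
                      (Torus.geometry (Fin 3)) (hsDiameter σ N) (Alexander.stateAfter
                      (Torus.geometry (Fin 3)) (hsDiameter σ N) z m)).toReal
                      (Alexander.stateAfter (Torus.geometry (Fin 3)) (hsDiameter σ N) z m)) i).2 -
                    ((freeFlight (Torus.geometry (Fin 3)) (Alexander.freeExitTime
                      (Torus.geometry (Fin 3)) (hsDiameter σ N) (Alexander.stateAfter
                      (Torus.geometry (Fin 3)) (hsDiameter σ N) z m)).toReal
                      (Alexander.stateAfter (Torus.geometry (Fin 3)) (hsDiameter σ N) z m)) j).2‖ ^ 3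
                else 0))
          ∂(localGibbsLaw σ a₀ u₀ θ₀ N (Φ N)) ≤ ENNReal.ofReal C := by
  -- domination by a homogeneous Gibbs law, and rung 0 for that law
  obtain ⟨θ₁, hθ₁, Λ, hΛ, hdom⟩ := exists_localGibbsMeasure_le_smul_const ha hθ hu ha0 hθ0
  obtain ⟨σ₀, hσ₀, hrung⟩ := collisionMomentBound_const one_pos hθ₁ (0 : V3)
  refine ⟨min σ₀ (1 / 2), lt_min hσ₀ (by norm_num), fun σ hσ hσlt Φ t ht N => ?_⟩
  have hσ₀' : σ < σ₀ := hσlt.trans_le (min_le_left _ _)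
  have hσ2 : σ ≤ 1 / 2 := (hσlt.trans_le (min_le_right _ _)).le
  obtain ⟨C₀, hC₀⟩ := hrung σ hσ hσ₀' Φ t ht
  refine ⟨Λ ^ (N + 1) * C₀, ?_⟩
  have hΛN : 0 ≤ Λ ^ (N + 1) := pow_nonneg (zero_le_one.trans hΛ) _
  have hle : localGibbsLaw σ a₀ u₀ θ₀ N (Φ N) ≤
      ENNReal.ofReal (Λ ^ (N + 1)) • localGibbsLaw σ (fun _ => 1) (fun _ => (0 : V3)) (fun _ => θ₁) N (Φ N) := by
    rw [localGibbsLaw_eq, localGibbsLaw_eq]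
    exact hdom σ hσ2 N
  refine (lintegral_mono' hle le_rfl).trans ?_
  rw [lintegral_smul_measure, ENNReal.ofReal_mul hΛN]
  exact mul_le_mul' le_rfl (hC₀ N)

end Summit.AtomisticToContinuum.HydrodynamicLimit.Theorems.LambertianContactSwapCollisionMomentBound

end
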